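import Summits.AtomisticToContinuum.FouriersLaw.Theorems.BondHeatUncertaintyExtensiveSnapshotIrreversibilityOddLogDensityOfRegularity
import HarnessLib

/-!
# Crux `ExtensiveSnapshotIrreversibility` (stmt-AtomisticToContinuum-9121), line `clausius-budget-sound-window`:
stub S1g' `stub_oddLogDensity_of_oddRegularity` — helper file (odd dominated-convergence bookkeeping)

Support lemmas for the registered stub S1g' of the lead's checked skeleton (v8) of the line: the ODD
regularity statement (R') of the NESS log-density (`μ_δ = μ_T · e^{φ_δ}` with the one-sided bound
`φ_δ ≤ η(1 + H)`, `φ_δ → 0`, `|φ_δ − φ_δ∘Θ| ≤ C|δ|(1 + H)^k`, `(φ_δ − φ_δ∘Θ)/δ → d₀` pointwise)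
implies the quadratic-mean first-order control of the odd log-density (S1d). This file carries the
purely analytic half, for the pinned anharmonic chain `P = pinnedChain ω₂ lam β γ` at temperature
`T > 0` (Gibbs state `μ_T = P.gibbsMeasure N T`, flip `Θ(q, p) = (q, -p)`); it is the odd-only
variant of `…OddLogDensityOfRegularityAux1` (landed, two-sided bounds):

* the mean-value bound `|e^a − e^b| ≤ e^{max(a,b)} |a − b|` and the limit
  `(e^{u} − e^{v})/δ → a` when `v → 0`, `(u − v)/δ → a`;
* odd DCT #1 (`tendsto_integral_oddQuot_sq_mul_exp`):
  `∫ ((φ_δ − φ_δ∘Θ)/δ)² e^{φ_δ} dμ_T → ∫ d₀² dμ_T` (domination by `C²(1 + H)^{2k} e^{η(1+H)}`,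
  only the UPPER bound on `φ_δ` enters);
* odd DCT #2 (`tendsto_integral_mul_expFlipQuot`, `oddDiffQuot_eq_integral`): if
  `ν_δ = μ_T · e^{φ_δ}` for `0 < |δ| < δ₀`, then for every continuous compactly supported `F`,
  `(∫ F dν_δ − ∫ F dμ_T)/δ − (∫ F∘Θ dν_δ − ∫ F∘Θ dμ_T)/δ = ∫ F (e^{φ_δ} − e^{φ_δ∘Θ})/δ dμ_T → ∫ F d₀ dμ_T`
  (flip-invariance of `μ_T`, `gibbsMeasure_map_flip`; domination by `‖F‖_∞ C(1 + H)^k e^{η(1+H)}`).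

The closed form `oddLogDensity_oddQuadraticMeanLimit` of odd DCT #1 is the registered sub-goal of the
item served by this file. No new definitions. References: J. A. McLennan, Phys. Rev. 115 (1959) 1405;
C. Maes, K. Netočný, J. Math. Phys. 51 (2010) 015219.
-/

noncomputable section

namespace Summit.AtomisticToContinuum.FouriersLaw.Theorems.ExtensiveSnapshotIrreversibility.ClausiusBudget

open MeasureTheory Filter Topology
open scoped ENNReal NNReal
open Literature.MathematicalPhysics.KineticTheory.HeatConduction
open Summit.AtomisticToContinuum.FouriersLaw.Theorems.ExtensiveSnapshotIrreversibility.Negative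
open Summit.AtomisticToContinuum.FouriersLaw.Theorems.ExtensiveSnapshotIrreversibility.ClausiusBudget.OddLogDensity

namespace OddLogDensity

open Real

/-! ## 1. Elementary real inequalities and limits (odd variants) -/

/-- Convexity bound `e^a − e^b ≤ e^a (a − b)` (from `1 + x ≤ eˣ` at `x = b − a`). [folklore] -/
theorem exp_sub_exp_le_exp_mul_sub (a b : ℝ) : exp a - exp b ≤ exp a * (a - b) := by
  have h1 : b - a + 1 ≤ exp (b - a) := add_one_le_exp (b - a)
  have h2 : exp (b - a) * exp a = exp b := by rw [← exp_add, sub_add_cancel]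
  have h3 := mul_le_mul_of_nonneg_right h1 (exp_pos a).le
  rw [h2] at h3
  nlinarith [h3]

/-- Mean-value bound `|e^a − e^b| ≤ e^{max(a,b)} |a − b|`. [folklore] -/
theorem abs_exp_sub_exp_le (a b : ℝ) : |exp a - exp b| ≤ exp (max a b) * |a - b| := by
  rcases le_total b a with h | h
  · rw [max_eq_left h, abs_of_nonneg (sub_nonneg.mpr (exp_le_exp.mpr h)),
      abs_of_nonneg (sub_nonneg.mpr h)]
    exact exp_sub_exp_le_exp_mul_sub a b
  · rw [max_eq_right h, abs_sub_comm, abs_of_nonneg (sub_nonneg.mpr (exp_le_exp.mpr h)),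
      abs_sub_comm, abs_of_nonneg (sub_nonneg.mpr h)]
    exact exp_sub_exp_le_exp_mul_sub b a

/-- If `v(δ) → 0` and `(u(δ) − v(δ))/δ → a` along `δ → 0`, `δ ≠ 0`, then `(e^{u(δ)} − e^{v(δ)})/δ → a`
(`e^u − e^v = e^v (e^{u−v} − 1)` and `tendsto_exp_sub_one_div`). [folklore] -/
theorem tendsto_exp_sub_exp_div {u v : ℝ → ℝ} {a : ℝ} (hv : Tendsto v (𝓝[≠] 0) (𝓝 0))
    (hu : Tendsto (fun δ => (u δ - v δ) / δ) (𝓝[≠] 0) (𝓝 a)) :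
    Tendsto (fun δ => (exp (u δ) - exp (v δ)) / δ) (𝓝[≠] 0) (𝓝 a) := by
  have h1 := tendsto_exp_sub_one_div hu
  have h2 : Tendsto (fun δ => exp (v δ)) (𝓝[≠] 0) (𝓝 (exp 0)) := (continuous_exp.tendsto 0).comp hv
  rw [exp_zero] at h2
  have h3 := h1.mul h2
  rw [mul_one] at h3
  refine h3.congr' (Eventually.of_forall fun δ => ?_)
  show (exp (u δ - v δ) - 1) / δ * exp (v δ) = (exp (u δ) - exp (v δ)) / δ
  rw [div_mul_eq_mul_div, sub_mul, one_mul, ← exp_add, sub_add_cancel]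

/-- Pointwise domination for the odd DCT #1: if `|a − b| ≤ C|δ|(1 + E)^k` and `a ≤ η(1 + E)` then
`((a − b)/δ)² e^a ≤ (C(1 + E)^k)² e^{η(1+E)}` (`δ ≠ 0`). [folklore] -/
theorem oddQuot_sq_mul_exp_le {a b δ C η E : ℝ} {k : ℕ} (hδ : δ ≠ 0)
    (hab : |a - b| ≤ C * |δ| * (1 + E) ^ k) (ha : a ≤ η * (1 + E)) :
    ((a - b) / δ) ^ 2 * exp a ≤ (C * (1 + E) ^ k) ^ 2 * exp (η * (1 + E)) := by
  have hδ' : 0 < |δ| := abs_pos.mpr hδ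
  have h1 : |(a - b) / δ| ≤ C * (1 + E) ^ k := by
    rw [abs_div, div_le_iff₀ hδ']
    calc |a - b| ≤ C * |δ| * (1 + E) ^ k := hab
      _ = C * (1 + E) ^ k * |δ| := by ring
  have h2 : ((a - b) / δ) ^ 2 ≤ (C * (1 + E) ^ k) ^ 2 := by
    rw [← sq_abs]
    exact pow_le_pow_left₀ (abs_nonneg _) h1 2
  exact mul_le_mul h2 (exp_le_exp.mpr ha) (exp_pos a).le (sq_nonneg _)

/-- Pointwise domination for the odd DCT #2: if `|a − b| ≤ C|δ|(1 + E)^k` and `a, b ≤ η(1 + E)`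
then `|(e^a − e^b)/δ| ≤ C(1 + E)^k e^{η(1+E)}` (`δ ≠ 0`; mean-value bound). [folklore] -/
theorem abs_exp_sub_exp_div_le {a b δ C η E : ℝ} {k : ℕ} (hδ : δ ≠ 0)
    (hab : |a - b| ≤ C * |δ| * (1 + E) ^ k) (ha : a ≤ η * (1 + E)) (hb : b ≤ η * (1 + E)) :
    |(exp a - exp b) / δ| ≤ C * (1 + E) ^ k * exp (η * (1 + E)) := by
  have hδ' : 0 < |δ| := abs_pos.mpr hδ
  rw [abs_div, div_le_iff₀ hδ']
  calc |exp a - exp b| ≤ exp (max a b) * |a - b| := abs_exp_sub_exp_le a b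
    _ ≤ exp (η * (1 + E)) * (C * |δ| * (1 + E) ^ k) :=
        mul_le_mul (exp_le_exp.mpr (max_le ha hb)) hab (abs_nonneg _) (exp_pos _).le
    _ = C * (1 + E) ^ k * exp (η * (1 + E)) * |δ| := by ring

/-! ## 2. Gibbs-state integrability and the two dominated-convergence limits (odd variants) -/

section Gibbs

variable {ω₂ lam β : ℝ} (hω : 0 < ω₂) (hl : 0 ≤ lam) (hβ : 0 ≤ β) (γ : ℝ) (N : ℕ) {T : ℝ} (hT : 0 < T)
include hω hl hβ hT

/-- A measurable function dominated by `M e^{ψ}` with the ONE-SIDED bound `ψ ≤ η(1 + H)`, `η < 1/T`,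
is `μ_T`-integrable: `e^{ψ} F ∈ L¹(μ_T)` for `|F| ≤ M`. [folklore] -/
theorem integrable_exp_mul_of_le {η : ℝ} (hηT : η < 1 / T) {ψ F : PhaseSpace N → ℝ}
    (hψm : Measurable ψ) (hψ : ∀ x, ψ x ≤ η * (1 + (pinnedChain ω₂ lam β γ).hamiltonian N x))
    (hFm : AEStronglyMeasurable F ((pinnedChain ω₂ lam β γ).gibbsMeasure N T)) {M : ℝ}
    (hFM : ∀ x, |F x| ≤ M) :
    Integrable (fun x => exp (ψ x) * F x) ((pinnedChain ω₂ lam β γ).gibbsMeasure N T) := by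
  have hi := (pinnedChain_integrable_exp_mul_hamiltonian_gibbsMeasure hω hl hβ γ N hT hηT).const_mul
    (exp η * M)
  refine hi.mono' (hψm.exp.aestronglyMeasurable.mul hFm) (Eventually.of_forall fun x => ?_)
  rw [Real.norm_eq_abs, abs_mul, abs_of_pos (exp_pos _)]
  have hM : 0 ≤ M := (abs_nonneg _).trans (hFM x)
  have h1 : exp (ψ x) ≤ exp η * exp (η * (pinnedChain ω₂ lam β γ).hamiltonian N x) := by
    rw [← exp_add]
    refine exp_le_exp.mpr ((hψ x).trans (le_of_eq ?_))
    ring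
  calc exp (ψ x) * |F x| ≤ (exp η * exp (η * (pinnedChain ω₂ lam β γ).hamiltonian N x)) * M :=
        mul_le_mul h1 (hFM x) (abs_nonneg _) (by positivity)
    _ = exp η * M * exp (η * (pinnedChain ω₂ lam β γ).hamiltonian N x) := by ring

variable {δ₀ η C : ℝ} {k : ℕ} (hδ₀ : 0 < δ₀) (hηT : η < 1 / T)
  {φ : ℝ → PhaseSpace N → ℝ} {d₀ : PhaseSpace N → ℝ} (hφm : ∀ δ : ℝ, Measurable (φ δ))
  (hR2 : ∀ δ : ℝ, |δ| < δ₀ → ∀ x : PhaseSpace N,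
    φ δ x ≤ η * (1 + (pinnedChain ω₂ lam β γ).hamiltonian N x))
  (hR3 : ∀ δ : ℝ, |δ| < δ₀ → ∀ x : PhaseSpace N,
    |φ δ x - φ δ (x.1, -x.2)| ≤ C * |δ| * (1 + (pinnedChain ω₂ lam β γ).hamiltonian N x) ^ k)

omit hω hl hβ hT in
include hR2 hR3 in
/-- The domination of the odd DCT #1: for `0 < |δ| < δ₀`,
`((φ_δ − φ_δ∘Θ)/δ)² e^{φ_δ} ≤ (C(1 + H)^k)² e^{η(1+H)}`. [folklore] -/
theorem norm_oddQuot_sq_mul_exp_le {δ : ℝ} (hδ : δ ≠ 0) (hδ' : |δ| < δ₀) (x : PhaseSpace N) :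
    ‖((φ δ x - φ δ (x.1, -x.2)) / δ) ^ 2 * exp (φ δ x)‖ ≤
      (C * (1 + (pinnedChain ω₂ lam β γ).hamiltonian N x) ^ k) ^ 2 *
        exp (η * (1 + (pinnedChain ω₂ lam β γ).hamiltonian N x)) := by
  rw [Real.norm_eq_abs, abs_of_nonneg (mul_nonneg (sq_nonneg _) (exp_pos _).le)]
  exact oddQuot_sq_mul_exp_le hδ (hR3 δ hδ' x) (hR2 δ hδ' x)

include hηT in
/-- The dominated integrand of the odd DCT #1 at ONE value `δ ≠ 0` is `μ_T`-integrable: for measurable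
`ψ ≤ η(1 + H)` (`η < 1/T`) with `|ψ − ψ∘Θ| ≤ C|δ|(1 + H)^k`, `((ψ − ψ∘Θ)/δ)² e^{ψ} ∈ L¹(μ_T)`.
[folklore] -/
theorem integrable_oddQuot_sq_mul_exp {ψ : PhaseSpace N → ℝ} (hψm : Measurable ψ)
    (hψ2 : ∀ x : PhaseSpace N, ψ x ≤ η * (1 + (pinnedChain ω₂ lam β γ).hamiltonian N x))
    {δ : ℝ} (hδ : δ ≠ 0)
    (hψ3 : ∀ x : PhaseSpace N,
      |ψ x - ψ (x.1, -x.2)| ≤ C * |δ| * (1 + (pinnedChain ω₂ lam β γ).hamiltonian N x) ^ k) :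
    Integrable (fun x => ((ψ x - ψ (x.1, -x.2)) / δ) ^ 2 * exp (ψ x))
      ((pinnedChain ω₂ lam β γ).gibbsMeasure N T) := by
  have hΘm : Measurable (fun y : PhaseSpace N => ((y.1, -y.2) : PhaseSpace N)) :=
    measurable_fst.prodMk measurable_snd.neg
  have hi := (integrable_one_add_pow_mul_exp_gibbs hω hl hβ γ N hT (2 * k) hηT).const_mul
    (C ^ 2 * exp η)
  refine hi.mono'
    ((((hψm.sub (hψm.comp hΘm)).div_const δ).pow_const 2).mul hψm.exp).aestronglyMeasurable
    (Eventually.of_forall fun x => ?_)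
  rw [Real.norm_eq_abs, abs_of_nonneg (mul_nonneg (sq_nonneg _) (exp_pos _).le)]
  refine (oddQuot_sq_mul_exp_le hδ (hψ3 x) (hψ2 x)).trans (le_of_eq ?_)
  have : exp (η * (1 + (pinnedChain ω₂ lam β γ).hamiltonian N x)) =
      exp η * exp (η * (pinnedChain ω₂ lam β γ).hamiltonian N x) := by
    rw [← exp_add]; ring_nf
  rw [this]; ring

include hδ₀ hηT hφm hR2 hR3 in
/-- **Odd DCT #1.** Under (R2u), (R3o), (R0) `φ_δ → 0` and (R4o) `(φ_δ − φ_δ∘Θ)/δ → d₀` pointwise: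
`∫ ((φ_δ − φ_δ∘Θ)/δ)² e^{φ_δ} dμ_T → ∫ d₀² dμ_T` along `δ → 0`, `δ ≠ 0`. [folklore] -/
theorem tendsto_integral_oddQuot_sq_mul_exp
    (hR0 : ∀ x : PhaseSpace N, Tendsto (fun δ : ℝ => φ δ x) (𝓝[≠] (0 : ℝ)) (𝓝 0))
    (hR4 : ∀ x : PhaseSpace N,
      Tendsto (fun δ : ℝ => (φ δ x - φ δ (x.1, -x.2)) / δ) (𝓝[≠] (0 : ℝ)) (𝓝 (d₀ x))) :
    Tendsto (fun δ : ℝ => ∫ x, ((φ δ x - φ δ (x.1, -x.2)) / δ) ^ 2 * exp (φ δ x)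
        ∂(pinnedChain ω₂ lam β γ).gibbsMeasure N T) (𝓝[≠] (0 : ℝ))
      (𝓝 (∫ x, d₀ x ^ 2 ∂(pinnedChain ω₂ lam β γ).gibbsMeasure N T)) := by
  have hΘm : Measurable (fun y : PhaseSpace N => ((y.1, -y.2) : PhaseSpace N)) :=
    measurable_fst.prodMk measurable_snd.neg
  refine tendsto_integral_filter_of_dominated_convergence
    (fun x => (C * (1 + (pinnedChain ω₂ lam β γ).hamiltonian N x) ^ k) ^ 2 *
      exp (η * (1 + (pinnedChain ω₂ lam β γ).hamiltonian N x))) ?_ ?_ ?_ ?_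
  · exact Eventually.of_forall fun δ =>
      (((((hφm δ).sub ((hφm δ).comp hΘm)).div_const δ).pow_const 2).mul
        (hφm δ).exp).aestronglyMeasurable
  · filter_upwards [eventually_ne_and_abs_lt hδ₀] with δ hδ
    exact ae_of_all _ fun x => norm_oddQuot_sq_mul_exp_le γ N hR2 hR3 hδ.1 hδ.2 x
  · have hi := (integrable_one_add_pow_mul_exp_gibbs hω hl hβ γ N hT (2 * k) hηT).const_mul
      (C ^ 2 * exp η)
    refine hi.congr (Eventually.of_forall fun x => ?_)
    have : exp (η * (1 + (pinnedChain ω₂ lam β γ).hamiltonian N x)) =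
        exp η * exp (η * (pinnedChain ω₂ lam β γ).hamiltonian N x) := by
      rw [← exp_add]; ring_nf
    simp only [this]; ring
  · refine ae_of_all _ fun x => ?_
    have h2 : Tendsto (fun δ : ℝ => exp (φ δ x)) (𝓝[≠] (0 : ℝ)) (𝓝 (exp 0)) :=
      (continuous_exp.tendsto 0).comp (hR0 x)
    rw [exp_zero] at h2
    have := ((hR4 x).pow 2).mul h2
    rwa [mul_one] at this

include hδ₀ hηT hφm hR2 hR3 in
/-- **Odd DCT #2.** Under (R2u), (R3o), (R0), (R4o), for every continuous compactly supported `F`: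
`∫ F (e^{φ_δ} − e^{φ_δ∘Θ})/δ dμ_T → ∫ F d₀ dμ_T` along `δ → 0`, `δ ≠ 0` (domination by
`‖F‖_∞ C(1 + H)^k e^{η(1+H)}`, mean-value bound; `H∘Θ = H`). [folklore] -/
theorem tendsto_integral_mul_expFlipQuot
    (hR0 : ∀ x : PhaseSpace N, Tendsto (fun δ : ℝ => φ δ x) (𝓝[≠] (0 : ℝ)) (𝓝 0))
    (hR4 : ∀ x : PhaseSpace N,
      Tendsto (fun δ : ℝ => (φ δ x - φ δ (x.1, -x.2)) / δ) (𝓝[≠] (0 : ℝ)) (𝓝 (d₀ x)))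
    {F : PhaseSpace N → ℝ} (hF : Continuous F) (hFc : HasCompactSupport F) :
    Tendsto (fun δ : ℝ => ∫ x, F x * ((exp (φ δ x) - exp (φ δ (x.1, -x.2))) / δ)
        ∂(pinnedChain ω₂ lam β γ).gibbsMeasure N T) (𝓝[≠] (0 : ℝ))
      (𝓝 (∫ x, F x * d₀ x ∂(pinnedChain ω₂ lam β γ).gibbsMeasure N T)) := by
  have hΘm : Measurable (fun y : PhaseSpace N => ((y.1, -y.2) : PhaseSpace N)) :=
    measurable_fst.prodMk measurable_snd.neg
  obtain ⟨M, hM⟩ := hF.bounded_above_of_compact_support hFc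
  have hFM : ∀ x, |F x| ≤ M := fun x => (Real.norm_eq_abs _).symm.le.trans (hM x)
  have hM0 : 0 ≤ M := (norm_nonneg _).trans (hM 0)
  refine tendsto_integral_filter_of_dominated_convergence
    (fun x => M * (C * (1 + (pinnedChain ω₂ lam β γ).hamiltonian N x) ^ k *
      exp (η * (1 + (pinnedChain ω₂ lam β γ).hamiltonian N x)))) ?_ ?_ ?_ ?_
  · exact Eventually.of_forall fun δ =>
      hF.aestronglyMeasurable.mul
        ((((hφm δ).exp.sub ((hφm δ).comp hΘm).exp).div_const δ).aestronglyMeasurable)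
  · filter_upwards [eventually_ne_and_abs_lt hδ₀] with δ hδ
    refine ae_of_all _ fun x => ?_
    rw [Real.norm_eq_abs, abs_mul]
    have hb : φ δ (x.1, -x.2) ≤ η * (1 + (pinnedChain ω₂ lam β γ).hamiltonian N x) := by
      have := hR2 δ hδ.2 (x.1, -x.2)
      rwa [OscillatorChain.hamiltonian_neg_momentum] at this
    exact mul_le_mul (hFM x) (abs_exp_sub_exp_div_le hδ.1 (hR3 δ hδ.2 x) (hR2 δ hδ.2 x) hb)
      (abs_nonneg _) hM0
  · have hi := (integrable_one_add_pow_mul_exp_gibbs hω hl hβ γ N hT k hηT).const_mul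
      (M * C * exp η)
    refine hi.congr (Eventually.of_forall fun x => ?_)
    have : exp (η * (1 + (pinnedChain ω₂ lam β γ).hamiltonian N x)) =
        exp η * exp (η * (pinnedChain ω₂ lam β γ).hamiltonian N x) := by
      rw [← exp_add]; ring_nf
    simp only [this]; ring
  · exact ae_of_all _ fun x =>
      (tendsto_exp_sub_exp_div (hR0 (x.1, -x.2)) (hR4 x)).const_mul (F x)

include hηT hφm hR2 in
/-- The odd difference quotient in closed form: if `ν_δ = μ_T · e^{φ_δ}` (`0 < |δ| < δ₀`), then for
continuous compactly supported `F`,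
`(∫ F dν_δ − ∫ F dμ_T)/δ − (∫ F∘Θ dν_δ − ∫ F∘Θ dμ_T)/δ = ∫ F (e^{φ_δ} − e^{φ_δ∘Θ})/δ dμ_T`
(flip-invariance of `μ_T`, `gibbsMeasure_map_flip`). [folklore] -/
theorem oddDiffQuot_eq_integral {ν : ℝ → Measure (PhaseSpace N)}
    (hν : ∀ δ : ℝ, δ ≠ 0 → |δ| < δ₀ → ν δ =
      ((pinnedChain ω₂ lam β γ).gibbsMeasure N T).withDensity (fun x => ENNReal.ofReal (exp (φ δ x))))
    {F : PhaseSpace N → ℝ} (hF : Continuous F) (hFc : HasCompactSupport F) {δ : ℝ} (hδ : δ ≠ 0)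
    (hδ' : |δ| < δ₀) :
    ((∫ x, F x ∂(ν δ)) - ∫ x, F x ∂(pinnedChain ω₂ lam β γ).gibbsMeasure N T) / δ -
        ((∫ x, F (x.1, -x.2) ∂(ν δ)) -
          ∫ x, F (x.1, -x.2) ∂(pinnedChain ω₂ lam β γ).gibbsMeasure N T) / δ =
      ∫ x, F x * ((exp (φ δ x) - exp (φ δ (x.1, -x.2))) / δ)
        ∂(pinnedChain ω₂ lam β γ).gibbsMeasure N T := by
  set μT := (pinnedChain ω₂ lam β γ).gibbsMeasure N T with hμT
  haveI : IsProbabilityMeasure μT := pinnedChain_isProbabilityMeasure_gibbsMeasure hω hl hβ γ N hT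
  have hΘm : Measurable (fun y : PhaseSpace N => ((y.1, -y.2) : PhaseSpace N)) :=
    measurable_fst.prodMk measurable_snd.neg
  have hmp : MeasurePreserving (momentumReversal N) μT μT :=
    ⟨(momentumReversal N).measurable, gibbsMeasure_map_flip _ N T⟩
  obtain ⟨M, hM⟩ := hF.bounded_above_of_compact_support hFc
  have hFM : ∀ x, |F x| ≤ M := fun x => (Real.norm_eq_abs _).symm.le.trans (hM x)
  have hflt : ∀ᵐ x ∂μT, ENNReal.ofReal (exp (φ δ x)) < ∞ :=
    Eventually.of_forall fun _ => ENNReal.ofReal_lt_top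
  have hpt : ∀ (x : PhaseSpace N) (r : ℝ),
      (ENNReal.ofReal (exp (φ δ x))).toReal • r = exp (φ δ x) * r := fun x r => by
    rw [ENNReal.toReal_ofReal (exp_pos _).le, smul_eq_mul]
  have h1 : ∫ x, F x ∂(ν δ) = ∫ x, exp (φ δ x) * F x ∂μT := by
    rw [hν δ hδ hδ', integral_withDensity_eq_integral_toReal_smul (hφm δ).exp.ennreal_ofReal hflt]
    simp_rw [hpt]
  have h2 : ∫ x, F (x.1, -x.2) ∂(ν δ) = ∫ x, exp (φ δ (x.1, -x.2)) * F x ∂μT := by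
    rw [hν δ hδ hδ', integral_withDensity_eq_integral_toReal_smul (hφm δ).exp.ennreal_ofReal hflt]
    simp_rw [hpt]
    have e := hmp.integral_comp' (fun y => exp (φ δ (y.1, -y.2)) * F y)
    simp only [momentumReversal_apply, neg_neg, Prod.mk.eta] at e
    exact e
  have h3 : ∫ x, F (x.1, -x.2) ∂μT = ∫ x, F x ∂μT := hmp.integral_comp' F
  have hi1 : Integrable (fun x => exp (φ δ x) * F x) μT :=
    integrable_exp_mul_of_le hω hl hβ γ N hT hηT (hφm δ) (hR2 δ hδ') hF.aestronglyMeasurable hFM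
  have hi2 : Integrable (fun x => exp (φ δ (x.1, -x.2)) * F x) μT :=
    integrable_exp_mul_of_le hω hl hβ γ N hT hηT ((hφm δ).comp hΘm)
      (fun x => by
        have := hR2 δ hδ' (x.1, -x.2)
        rwa [OscillatorChain.hamiltonian_neg_momentum] at this)
      hF.aestronglyMeasurable hFM
  rw [h1, h2, h3, ← sub_div, sub_sub_sub_cancel_right, ← integral_sub hi1 hi2, ← integral_div]
  refine integral_congr_ae (ae_of_all _ fun x => ?_)
  ring

end Gibbs

end OddLogDensity

/-! ## 3. Registered sub-goal (closed form of the odd DCT #1) -/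

open OddLogDensity in
/-- **Registered sub-goal `oddLogDensity_oddQuadraticMeanLimit`** of crux stmt-AtomisticToContinuum-9121 (under
`stub_oddLogDensity_of_oddRegularity`): `OddLogDensity.tendsto_integral_oddQuot_sq_mul_exp` in closed form — for the
pinned chain (`ω₂ > 0`, `lam, β ≥ 0`, `T > 0`), measurable `φ_δ` with `φ_δ ≤ η(1 + H)` (`η < 1/T`),
`|φ_δ − φ_δ∘Θ| ≤ C|δ|(1 + H)^k` on `|δ| < δ₀`, `φ_δ → 0` and `(φ_δ − φ_δ∘Θ)/δ → d₀` pointwise: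
`∫ ((φ_δ − φ_δ∘Θ)/δ)² e^{φ_δ} dμ_T → ∫ d₀² dμ_T` along `δ → 0`, `δ ≠ 0`. [folklore] -/
theorem oddLogDensity_oddQuadraticMeanLimit : ∀ ω₂ lam β γ : ℝ, 0 < ω₂ → 0 ≤ lam → 0 ≤ β → ∀ (N : ℕ) (T : ℝ), 0 < T → ∀ (δ₀ η C : ℝ) (k : ℕ), 0 < δ₀ → η < 1 / T → ∀ (φ : ℝ → PhaseSpace N → ℝ) (d₀ : PhaseSpace N → ℝ), (∀ δ : ℝ, Measurable (φ δ)) → (∀ δ : ℝ, |δ| < δ₀ → ∀ x : PhaseSpace N, φ δ x ≤ η * (1 + (pinnedChain ω₂ lam β γ).hamiltonian N x)) → (∀ δ : ℝ, |δ| < δ₀ → ∀ x : PhaseSpace N, |φ δ x - φ δ (x.1, -x.2)| ≤ C * |δ| * (1 + (pinnedChain ω₂ lam β γ).hamiltonian N x) ^ k) → (∀ x : PhaseSpace N, Tendsto (fun δ : ℝ => φ δ x) (𝓝[≠] (0 : ℝ)) (𝓝 0)) → (∀ x : PhaseSpace N, Tendsto (fun δ : ℝ => (φ δ x - φ δ (x.1,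 -x.2)) / δ) (𝓝[≠] (0 : ℝ)) (𝓝 (d₀ x))) → Tendsto (fun δ : ℝ => ∫ x, ((φ δ x - φ δ (x.1, -x.2)) / δ) ^ 2 * Real.exp (φ δ x) ∂(pinnedChain ω₂ lam β γ).gibbsMeasure N T) (𝓝[≠] (0 : ℝ)) (𝓝 (∫ x, d₀ x ^ 2 ∂(pinnedChain ω₂ lam β γ).gibbsMeasure N T)) :=
  fun _ _ _ γ hω hl hβ N _ hT _ _ _ _ hδ₀ hηT _ _ hφm hR2 hR3 hR0 hR4 =>
    tendsto_integral_oddQuot_sq_mul_exp hω hl hβ γ N hT hδ₀ hηT hφm hR2 hR3 hR0 hR4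

end Summit.AtomisticToContinuum.FouriersLaw.Theorems.ExtensiveSnapshotIrreversibility.ClausiusBudget

end
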